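import Summits.NavierStokesRegularity.NavierStokesRegularity.Theorems.ExtremiserTransiencePerFlowSubExtremalStratum
import Summits.NavierStokesRegularity.NavierStokesRegularity.Theorems.ExtremiserTransienceNearExtremalTransienceCanonical
import Summits.NavierStokesRegularity.NavierStokesRegularity.Theorems.ExtremiserTransienceNearExtremalTransienceDSSPerFlowAnalytic
import Summits.NavierStokesRegularity.NavierStokesRegularity.Theorems.ExtremiserTransienceKStarAttainedHalfSpaceVariation
import HarnessLib

/-!
# Crux `NearExtremalTransiencePerFlow` (stmt-NavierStokesRegularity-26567) — LINE g7-β «zone transversality / no lingering at the top»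
# (seat ns-idea-5 g7, technique card: extremal-example mining): a CHECKED SKELETON, zoom-free and Liouville-free

Target BY NAME: `Summit.NavierStokesRegularity.NavierStokesRegularity.Theses.ExtremiserTransience.NearExtremalTransiencePerFlow`
(the route's rank-2 crux; rev 21).  Composition `NearExtremalTransiencePerFlow_of` is kernel-checked; the only `sorry`s are the four
registered stubs `stub_*`.

THE OBJECT.  For a flow of the crux (classical Leray–Hopf on `[0,T) × ℝ³`, rapidly decaying datum, eventual Type-I rate
`√(T−t)‖u(t)‖_∞ ≤ C√ν`, no smooth extension past `T`) let `k₀` be the landed MINIMAL measurable depletion coefficient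
(`DepletionLadder.exists_canonical_coefficient`: flow-wise clause on `[0,T)` + minimality; so `k₀(t) = |J|/(N√Z√P)(t)` is the slice
EFFICIENCY, and `k₀ < κ⋆` on `(0,T)` is the landed `DepletionLadder.minimalCoeff_lt_sharp_of_pos`).  The ε-ZONE is the set of late times with
`k₀ ≥ κ⋆ − ε`; a SOJOURN is a closed time interval spent inside the zone, measured in LOG-TIME `log((T−s)/(T−t))` (= number of turnovers at
the Type-I rate).

THE LEVER (new on this crux: a statement about the NS SEMIFLOW near the near-extremal set, local in time, no blow-up zoom, no compactness,
no ancient/Liouville endgame).  Extremal-example mining of the maximisers of `|J|/(κ⋆ M √Z √W)` (numerical record `R ≈ 0.144`, jobs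
j021500/j021517; bang-bang structure: `‖v‖ = M` on a core, K1b/`KStar.not_attained_of_analyticOnNhd`: no analytic field attains `κ⋆`)
says the near-extremal set is a THIN RIDGE that the Navier–Stokes vector field crosses TRANSVERSALLY: the inviscid rate `d(log k₀)/d(log-time)`
is ODD under `u ↦ −u` (so a near-maximiser is entered from one side and left by the other — the efficiency has a Λ-corner at a bang-bang peak,
it does not plateau), and viscosity at slice Reynolds number `Re_λ ≍ C` tilts it further.  «No lingering»: a Type-I flow cannot sit in the
ε-zone for more than `L` turnovers.
* `stub_sojournBound` (Z1, the OPEN HEART, L–XL): ∃ ε > 0, L, onset t₁: every in-zone sojourn `[s,t] ⊂ [t₁,T)` has log-length ≤ L.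
  Why it might fail: the flow may be nearly TANGENT to the ridge (a slowly modulated cascade regenerating near-maximisers scale after scale with
  staggered phases; crowds give flat directions of the efficiency), making sojourns unboundedly long with deficit `ε(t) → 0`.
* `stub_zoneLipschitz` (Z2, M/L): in the zone `k₀` is log-Lipschitz: `|k₀ t − k₀ s| ≤ Λ·log((T−s)/(T−t))` on in-zone intervals — one time
  derivative of `J, Z, P, N` at near-efficient times, where `|J| ≤ ‖∇u‖_∞ Z ≤ C₁Z/(T−t)` (gradient Type-I rate) and the landed one-sided lock
  `νP/Z ≤ C₁²/(m²c₀²(T−t))` (`PerFlow.lowerLock…`, unconditional) bound `d log Z`; why it might fail: `ν‖Δω‖²/P` and the `‖∇²u‖_∞√Z√P` production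
  term are controlled only under the OTHER half of the lock (`Z ≤ c₂ν(T−t)P`, known on a non-null set of times, not pointwise), so `k₀` may jump
  when sub-Taylor-scale palinstrophy burns off.
* `stub_efficiencyContinuous` (Z3, M): `k₀` is continuous on `(0,T)` (minimality pins `k₀ = |J|/(N√Z√P)` at non-trivial slices — a trivial slice
  would extend smoothly; `Z, P` continuous in time is the landed `PerFlow…EnstrophyContinuity`, `J` likewise, `N = sup‖u(t,·)‖` by slab regularity).
* `stub_zoneCalculus` (Z4, pure real analysis, M in Lean): continuity + sojourn bound + zone-Lipschitz + `0 ≤ k ≤ κs` ⇒ the log-mean of `k²`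
  is at most `(θ₀κs)²` for some `θ₀ < 1` (window argument: every log-window of length `L+1` holds a time below `κs−ε`; the climb back to `κs−ε/2`
  takes log-time ≥ `ε/(2Λ)` inside `{k ≤ κs − ε/2}`; so that set has log-density ≥ `min(ε/(2Λ), L+1)/(2(L+1))`).
Composition (kernel-checked): onset `t₃ = max(t₁,t₂,T/2)`, zone width `min ε ε'`, `κs = κ⋆` (`k₀ ≤ κ⋆` from `minimalCoeff_lt_sharp_of_pos`),
then `(θ₀κ⋆)² ≤ (θ₀κ)²` for every universal `κ` (`sharpDepletion_le`) gives the crux's conclusion with `θ = θ₀`, `k = k₀`; contradiction with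
the violator frame.
RELATION TO THE ROUTE'S OTHER LINES: 27676/28317 (near-plateau stability, static, δ-uniform), 27822/28318 (blow-up zoom to a weak ancient
slice, ex falso `plateauSliceRigidity`), `bangbang_core` (first-variation density, efficient core K3), 21883's birth stub `SaturationExit`
(block log-DENSITY ≤ 1−δ, uniform in the flow): none of them is a statement about EXIT TIMES of the semiflow; Z1 alone does not bound the zone's
density (thin dips) — Z2+Z3 convert it; Z1 is time-reversal-consistent (the refuted-in-sketch «zone decay k₀↓ in the zone» is not: `e` RISES into
a bang-bang peak).  The landed strata `PerFlow.netpf_rung_monotoneStratum` / `netpf_rung_subExtremalStratum` are the rungs `L = 0` / «zone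
eventually empty» of this picture.
INSTRUMENT ROW (would refute Z1's mechanism): evolve ± a numerical near-maximiser (R ≈ 0.144 field) under NS at `Re_λ ∈ {1,3,10,30}` for three
turnovers and record `|dk₀/d log-time|` at `t = 0` and the sojourn length in `{k₀ ≥ k₀(0) − 0.01}`; Z1 dies if some near-maximiser LINGERS
(`|k₀'|·turnover < 10⁻³` over a turnover for both signs).  Bears on LADDER-NS rung N0 (hard core stmt-1217) only through the route's `closes`.
HONEST FRAMING: implications between OPEN statements about hypothetical Type-I singular flows and one scale-invariant functional; nothing about
Navier–Stokes regularity or blow-up is proved here; no summit is proved by a line.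
-/

noncomputable section

open scoped Topology InnerProductSpace RealInnerProductSpace ENNReal ContDiff
open MeasureTheory Filter Set Metric
open Literature.Analysis.FluidPDE
open Summit.NavierStokesRegularity.NavierStokesRegularity.Theses.ExtremiserTransience
open Summit.NavierStokesRegularity.NavierStokesRegularity.Theorems
open Summit.NavierStokesRegularity.NavierStokesRegularity.Theorems.DepletionLadder.KStar.HalfSpace

namespace Summit.NavierStokesRegularity.NavierStokesRegularity.Cruxes.NearExtremalTransiencePerFlow.ZoneTransversality

set_option linter.dupNamespace false
set_option linter.unusedVariables false

/-! ## §0 Vocabulary -/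

/-- The per-flow CONCLUSION of the crux for the flow `u` on `[0,T)` (verbatim). -/
def PFC (T : ℝ) (u : ℝ → EuclideanSpace ℝ (Fin 3) → EuclideanSpace ℝ (Fin 3)) : Prop :=
  ∃ θ : ℝ, 0 ≤ θ ∧ θ < 1 ∧ ∀ κ : ℝ, (∀ (v : EuclideanSpace ℝ (Fin 3) → EuclideanSpace ℝ (Fin 3)) (M B : ℝ), ContDiff ℝ (⊤ : ℕ∞) v → Literature.Analysis.FluidPDE.VectorCalculus.IsDivFree v → (∀ x, ‖v x‖ ≤ M) → (∀ x, ‖fderiv ℝ v x‖ ≤ B) → (∫⁻ x, ‖iteratedFDeriv ℝ 0 v x‖ₑ ^ 2 < ⊤) → (∫⁻ x, ‖iteratedFDeriv ℝ 1 v x‖ₑ ^ 2 < ⊤) → (∫⁻ x, ‖iteratedFDeriv ℝ 2 v x‖ₑ ^ 2 < ⊤) → |∫ x, ⟪Literature.Analysis.FluidPDE.curl v x, fderiv ℝ v x (Literature.Analysis.FluidPDE.curl v x)⟫_ℝ| ≤ κ * M * Real.sqrt (∫ x, ‖Literature.Analysis.FluidPDE.curl v x‖ ^ 2) * Real.sqrt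 (∫ x, Literature.Analysis.FluidPDE.frobeniusNormSq (fderiv ℝ (Literature.Analysis.FluidPDE.curl v) x))) → ∃ t₁ ∈ Set.Ico 0 T, ∃ (k : ℝ → ℝ) (B : ℝ), Measurable k ∧ (∀ τ, 0 ≤ k τ ∧ k τ ≤ 1) ∧ (∀ t ∈ Set.Ico t₁ T, ∀ M : ℝ, (∀ x, ‖u t x‖ ≤ M) → |∫ x, ⟪Literature.Analysis.FluidPDE.curl (u t) x, fderiv ℝ (u t) x (Literature.Analysis.FluidPDE.curl (u t) x)⟫_ℝ| ≤ k t * M * Real.sqrt (∫ x, ‖Literature.Analysis.FluidPDE.curl (u t) x‖ ^ 2) * Real.sqrt (∫ x, Literature.Analysis.FluidPDE.frobeniusNormSq (fderiv ℝ (Literature.Analysis.FluidPDE.curl (u t)) x))) ∧ (∀ t ∈ Set.Ico t₁ T, ∫ τ in t₁..t, k τ ^ 2 / (T - τ) ≤ (θ * κ) ^ 2 * Real.log ((T - t₁) / (T - t)) + B)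

/-- The VIOLATOR FRAME (contrapositive of the crux, as in items 27822/28318): a flow satisfying every hypothesis of
`NearExtremalTransiencePerFlow` whose per-flow conclusion fails. -/
def IsViolator (C ν T : ℝ) (u : ℝ → EuclideanSpace ℝ (Fin 3) → EuclideanSpace ℝ (Fin 3))
    (p : ℝ → EuclideanSpace ℝ (Fin 3) → ℝ) : Prop :=
  0 < C ∧ 0 < ν ∧ 0 < T ∧ IsClassicalNSSolutionOn (Set.Ico 0 T) ν 0 u p ∧ IsLerayHopfOn T ν 0 (u 0) u ∧
    HasRapidSpatialDecay (u 0) ∧ (∀ᶠ t in 𝓝[<] T, ∀ x, Real.sqrt (T - t) * ‖u t x‖ ≤ C * Real.sqrt ν) ∧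
    ¬ HasSmoothExtensionPast ν 0 u T ∧ ¬ PFC T u

/-- `k₀` is a MINIMAL measurable depletion coefficient of `u` on `[0,T)`: exactly the two properties delivered by the landed
`DepletionLadder.exists_canonical_coefficient` (flow-wise clause on `[0,T)`, and minimality among admissible values at each time). -/
def IsMinimalCoeff (T : ℝ) (u : ℝ → EuclideanSpace ℝ (Fin 3) → EuclideanSpace ℝ (Fin 3)) (k₀ : ℝ → ℝ) : Prop :=
  Measurable k₀ ∧ (∀ τ, 0 ≤ k₀ τ ∧ k₀ τ ≤ 1) ∧
    (∀ t ∈ Set.Ico 0 T, ∀ M : ℝ, (∀ x, ‖u t x‖ ≤ M) →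
      |∫ x, ⟪curl (u t) x, fderiv ℝ (u t) x (curl (u t) x)⟫_ℝ| ≤
        k₀ t * M * Real.sqrt (∫ x, ‖curl (u t) x‖ ^ 2) * Real.sqrt (∫ x, frobeniusNormSq (fderiv ℝ (curl (u t)) x))) ∧
    (∀ t ∈ Set.Ico 0 T, ∀ c : ℝ, 0 ≤ c →
      (∀ M : ℝ, (∀ x, ‖u t x‖ ≤ M) →
        |∫ x, ⟪curl (u t) x, fderiv ℝ (u t) x (curl (u t) x)⟫_ℝ| ≤
          c * M * Real.sqrt (∫ x, ‖curl (u t) x‖ ^ 2) * Real.sqrt (∫ x, frobeniusNormSq (fderiv ℝ (curl (u t)) x))) →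
      k₀ t ≤ c)

/-! ## §1 The four statements of the line -/

/-- (Z1, OPEN HEART) SOJOURN BOUND «no lingering at the top»: for a violator flow and its minimal coefficient there are a zone width
`ε > 0`, a bound `L` and an onset after which every closed interval spent in the zone `{k₀ ≥ κ⋆ − ε}` has log-length at most `L`. -/
def SojournBound : Prop :=
  ∀ (C ν T : ℝ) (u : ℝ → EuclideanSpace ℝ (Fin 3) → EuclideanSpace ℝ (Fin 3)) (p : ℝ → EuclideanSpace ℝ (Fin 3) → ℝ),
    IsViolator C ν T u p → ∀ k₀ : ℝ → ℝ, IsMinimalCoeff T u k₀ →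
      ∃ ε L : ℝ, 0 < ε ∧ 0 ≤ L ∧ ∃ t₁ ∈ Set.Ico 0 T, ∀ s t : ℝ, t₁ ≤ s → s ≤ t → t < T →
        (∀ τ ∈ Set.Icc s t, kStar - ε ≤ k₀ τ) → Real.log ((T - s) / (T - t)) ≤ L

/-- (Z2) ZONE LOG-LIPSCHITZ: in the zone the efficiency moves at most `Λ` per unit log-time. -/
def ZoneLipschitz : Prop :=
  ∀ (C ν T : ℝ) (u : ℝ → EuclideanSpace ℝ (Fin 3) → EuclideanSpace ℝ (Fin 3)) (p : ℝ → EuclideanSpace ℝ (Fin 3) → ℝ),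
    IsViolator C ν T u p → ∀ k₀ : ℝ → ℝ, IsMinimalCoeff T u k₀ →
      ∃ ε Λ : ℝ, 0 < ε ∧ 0 < Λ ∧ ∃ t₁ ∈ Set.Ico 0 T, ∀ s t : ℝ, t₁ ≤ s → s ≤ t → t < T →
        (∀ τ ∈ Set.Icc s t, kStar - ε ≤ k₀ τ) → |k₀ t - k₀ s| ≤ Λ * Real.log ((T - s) / (T - t))

/-- (Z3) CONTINUITY of the minimal coefficient on `(0,T)`. -/
def EfficiencyContinuous : Prop :=
  ∀ (C ν T : ℝ) (u : ℝ → EuclideanSpace ℝ (Fin 3) → EuclideanSpace ℝ (Fin 3)) (p : ℝ → EuclideanSpace ℝ (Fin 3) → ℝ),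
    IsViolator C ν T u p → ∀ k₀ : ℝ → ℝ, IsMinimalCoeff T u k₀ → ContinuousOn k₀ (Set.Ioo 0 T)

/-- (Z4) ZONE CALCULUS (pure real analysis): continuity + sojourn bound + zone-Lipschitz + `0 ≤ k ≤ κs` on `[t₁,T)` give a log-mean of
`k²` strictly below `κs²`. -/
def ZoneCalculus : Prop :=
  ∀ (k : ℝ → ℝ) (T t₁ κs ε L Λ : ℝ), 0 < κs → 0 < ε → 0 ≤ L → 0 < Λ → t₁ < T →
    Measurable k → (∀ τ, 0 ≤ k τ) → (∀ τ ∈ Set.Ico t₁ T, k τ ≤ κs) → ContinuousOn k (Set.Ico t₁ T) →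
    (∀ s t : ℝ, t₁ ≤ s → s ≤ t → t < T → (∀ τ ∈ Set.Icc s t, κs - ε ≤ k τ) →
      Real.log ((T - s) / (T - t)) ≤ L) →
    (∀ s t : ℝ, t₁ ≤ s → s ≤ t → t < T → (∀ τ ∈ Set.Icc s t, κs - ε ≤ k τ) →
      |k t - k s| ≤ Λ * Real.log ((T - s) / (T - t))) →
    ∃ θ₀ B : ℝ, 0 ≤ θ₀ ∧ θ₀ < 1 ∧ ∀ t ∈ Set.Ico t₁ T,
      ∫ τ in t₁..t, k τ ^ 2 / (T - τ) ≤ (θ₀ * κs) ^ 2 * Real.log ((T - t₁) / (T - t)) + B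

/-! ## §2 Registered stubs (the only `sorry`s; statements = §1 unfolded one level) -/

/-- Z1 (OPEN HEART, L–XL). -/
theorem stub_sojournBound :
    ∀ (C ν T : ℝ) (u : ℝ → EuclideanSpace ℝ (Fin 3) → EuclideanSpace ℝ (Fin 3)) (p : ℝ → EuclideanSpace ℝ (Fin 3) → ℝ),
    IsViolator C ν T u p → ∀ k₀ : ℝ → ℝ, IsMinimalCoeff T u k₀ →
      ∃ ε L : ℝ, 0 < ε ∧ 0 ≤ L ∧ ∃ t₁ ∈ Set.Ico 0 T, ∀ s t : ℝ, t₁ ≤ s → s ≤ t → t < T →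
        (∀ τ ∈ Set.Icc s t, kStar - ε ≤ k₀ τ) → Real.log ((T - s) / (T - t)) ≤ L := by
  sorry

/-- Z2 (M/L). -/
theorem stub_zoneLipschitz :
    ∀ (C ν T : ℝ) (u : ℝ → EuclideanSpace ℝ (Fin 3) → EuclideanSpace ℝ (Fin 3)) (p : ℝ → EuclideanSpace ℝ (Fin 3) → ℝ),
    IsViolator C ν T u p → ∀ k₀ : ℝ → ℝ, IsMinimalCoeff T u k₀ →
      ∃ ε Λ : ℝ, 0 < ε ∧ 0 < Λ ∧ ∃ t₁ ∈ Set.Ico 0 T, ∀ s t : ℝ, t₁ ≤ s → s ≤ t → t < T →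
        (∀ τ ∈ Set.Icc s t, kStar - ε ≤ k₀ τ) → |k₀ t - k₀ s| ≤ Λ * Real.log ((T - s) / (T - t)) := by
  sorry

/-- Z3 (M). -/
theorem stub_efficiencyContinuous :
    ∀ (C ν T : ℝ) (u : ℝ → EuclideanSpace ℝ (Fin 3) → EuclideanSpace ℝ (Fin 3)) (p : ℝ → EuclideanSpace ℝ (Fin 3) → ℝ),
    IsViolator C ν T u p → ∀ k₀ : ℝ → ℝ, IsMinimalCoeff T u k₀ → ContinuousOn k₀ (Set.Ioo 0 T) := by
  sorry

/-- Z4 (pure real analysis, M). -/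
theorem stub_zoneCalculus :
    ∀ (k : ℝ → ℝ) (T t₁ κs ε L Λ : ℝ), 0 < κs → 0 < ε → 0 ≤ L → 0 < Λ → t₁ < T →
    Measurable k → (∀ τ, 0 ≤ k τ) → (∀ τ ∈ Set.Ico t₁ T, k τ ≤ κs) → ContinuousOn k (Set.Ico t₁ T) →
    (∀ s t : ℝ, t₁ ≤ s → s ≤ t → t < T → (∀ τ ∈ Set.Icc s t, κs - ε ≤ k τ) →
      Real.log ((T - s) / (T - t)) ≤ L) →
    (∀ s t : ℝ, t₁ ≤ s → s ≤ t → t < T → (∀ τ ∈ Set.Icc s t, κs - ε ≤ k τ) →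
      |k t - k s| ≤ Λ * Real.log ((T - s) / (T - t))) →
    ∃ θ₀ B : ℝ, 0 ≤ θ₀ ∧ θ₀ < 1 ∧ ∀ t ∈ Set.Ico t₁ T,
      ∫ τ in t₁..t, k τ ^ 2 / (T - τ) ≤ (θ₀ * κs) ^ 2 * Real.log ((T - t₁) / (T - t)) + B := by
  sorry

namespace Registered
/-- Registered name of Z1. -/
abbrev stub_sojournBound : Prop := SojournBound
/-- Registered name of Z2. -/
abbrev stub_zoneLipschitz : Prop := ZoneLipschitz
/-- Registered name of Z3. -/
abbrev stub_efficiencyContinuous : Prop := EfficiencyContinuous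
/-- Registered name of Z4. -/
abbrev stub_zoneCalculus : Prop := ZoneCalculus
end Registered

theorem stub_sojournBound_holds : Registered.stub_sojournBound := stub_sojournBound
theorem stub_zoneLipschitz_holds : Registered.stub_zoneLipschitz := stub_zoneLipschitz
theorem stub_efficiencyContinuous_holds : Registered.stub_efficiencyContinuous := stub_efficiencyContinuous
theorem stub_zoneCalculus_holds : Registered.stub_zoneCalculus := stub_zoneCalculus

/-! ## §3 Composition (kernel-checked): Z1 → Z2 → Z3 → Z4 → the crux BY NAME -/

theorem NearExtremalTransiencePerFlow_of (h1 : Registered.stub_sojournBound) (h2 : Registered.stub_zoneLipschitz)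
    (h3 : Registered.stub_efficiencyContinuous) (h4 : Registered.stub_zoneCalculus) :
    NearExtremalTransiencePerFlow := by
  have h1' : SojournBound := h1
  have h2' : ZoneLipschitz := h2
  have h3' : EfficiencyContinuous := h3
  have h4' : ZoneCalculus := h4
  intro C ν T hC hν hT u p hsol hLH hdec hrate hne
  by_contra hno
  have hV : IsViolator C ν T u p := ⟨hC, hν, hT, hsol, hLH, hdec, hrate, hne, hno⟩
  obtain ⟨k₀, hk₀m, hk₀01, hcl, hmin⟩ := DepletionLadder.exists_canonical_coefficient hν hT hsol hLH hdec
  have hK : IsMinimalCoeff T u k₀ := ⟨hk₀m, hk₀01, hcl, hmin⟩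
  obtain ⟨ε, L, hε, hL, t₁, ht₁, hsoj⟩ := h1' C ν T u p hV k₀ hK
  obtain ⟨ε', Λ, hε', hΛ, t₂, ht₂, hlip⟩ := h2' C ν T u p hV k₀ hK
  have hcont : ContinuousOn k₀ (Set.Ioo 0 T) := h3' C ν T u p hV k₀ hK
  have hlt := DepletionLadder.minimalCoeff_lt_sharp_of_pos hν hT hsol hLH hdec hmin
  -- common onset `t₃ = max (max t₁ t₂) (T/2)` and common zone width `ε₀ = min ε ε'`
  set t₃ : ℝ := max (max t₁ t₂) (T / 2) with ht₃def
  have ht₃T : t₃ < T := max_lt (max_lt ht₁.2 ht₂.2) (by linarith)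
  have ht₃0 : 0 < t₃ := lt_of_lt_of_le (by linarith) (le_max_right _ _)
  have ht₁3 : t₁ ≤ t₃ := (le_max_left _ _).trans (le_max_left _ _)
  have ht₂3 : t₂ ≤ t₃ := (le_max_right _ _).trans (le_max_left _ _)
  set ε₀ : ℝ := min ε ε' with hε₀def
  have hε₀ : 0 < ε₀ := lt_min hε hε'
  have hks : ∀ τ ∈ Set.Ico t₃ T, k₀ τ ≤ kStar := by
    intro τ hτ
    have h := (hlt τ ⟨ht₃0.trans_le hτ.1, hτ.2⟩).le
    unfold kStar udcSet
    exact h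
  have hcont₃ : ContinuousOn k₀ (Set.Ico t₃ T) := hcont.mono fun τ hτ => ⟨ht₃0.trans_le hτ.1, hτ.2⟩
  have hsoj₃ : ∀ s t : ℝ, t₃ ≤ s → s ≤ t → t < T → (∀ τ ∈ Set.Icc s t, kStar - ε₀ ≤ k₀ τ) →
      Real.log ((T - s) / (T - t)) ≤ L := by
    intro s t hs hst htT hz
    refine hsoj s t (ht₁3.trans hs) hst htT fun τ hτ => ?_
    have : ε₀ ≤ ε := min_le_left _ _
    linarith [hz τ hτ]
  have hlip₃ : ∀ s t : ℝ, t₃ ≤ s → s ≤ t → t < T → (∀ τ ∈ Set.Icc s t, kStar - ε₀ ≤ k₀ τ) →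
      |k₀ t - k₀ s| ≤ Λ * Real.log ((T - s) / (T - t)) := by
    intro s t hs hst htT hz
    refine hlip s t (ht₂3.trans hs) hst htT fun τ hτ => ?_
    have : ε₀ ≤ ε' := min_le_right _ _
    linarith [hz τ hτ]
  obtain ⟨θ₀, B, hθ₀0, hθ₀1, hmean⟩ :=
    h4' k₀ T t₃ kStar ε₀ L Λ kStar_pos hε₀ hL hΛ ht₃T hk₀m (fun τ => (hk₀01 τ).1) hks hcont₃ hsoj₃ hlip₃
  apply hno
  refine ⟨θ₀, hθ₀0, hθ₀1, fun κ hκ => ?_⟩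
  have hκs : kStar ≤ κ := by
    unfold kStar udcSet
    exact DepletionLadder.sharpDepletion_le hκ
  refine ⟨t₃, ⟨ht₃0.le, ht₃T⟩, k₀, B, hk₀m, hk₀01,
    fun t ht M hM => hcl t ⟨ht₃0.le.trans ht.1, ht.2⟩ M hM, fun t ht => ?_⟩
  have hlog : 0 ≤ Real.log ((T - t₃) / (T - t)) :=
    Real.log_nonneg ((one_le_div (sub_pos.2 ht.2)).2 (by linarith [ht.1]))
  have h0 : 0 ≤ θ₀ * kStar := mul_nonneg hθ₀0 kStar_pos.le
  have hmono : (θ₀ * kStar) ^ 2 ≤ (θ₀ * κ) ^ 2 :=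
    pow_le_pow_left₀ h0 (mul_le_mul_of_nonneg_left hκs hθ₀0) 2
  calc ∫ τ in t₃..t, k₀ τ ^ 2 / (T - τ) ≤ (θ₀ * kStar) ^ 2 * Real.log ((T - t₃) / (T - t)) + B := hmean t ht
    _ ≤ (θ₀ * κ) ^ 2 * Real.log ((T - t₃) / (T - t)) + B := by nlinarith [hmono, hlog]

end Summit.NavierStokesRegularity.NavierStokesRegularity.Cruxes.NearExtremalTransiencePerFlow.ZoneTransversality
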